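import Summits.BirchSwinnertonDyer.Rank1Residual.X11b.BDPRouteLevelToKummerTorsion
import Summits.BirchSwinnertonDyer.Rank1Residual.X11b.PropagatedLocalConditions
import Summits.BirchSwinnertonDyer.Rank1Residual.X11b.LocalPrimaryFinite
import Literature.NumberTheory.EllipticCurves.LocalPointsIntegersSubgroup
import Literature.NumberTheory.EllipticCurves.LocalKummerMap
import HarnessLib

/-!
# X11b, routes p2/R1 — TORSION SATURATION of the local Kummer condition away from `p`, and
# Castella's level structure `𝓛^{(k)}` IS "Kummer away from `p`, torsion-Kummer at `𝔭`, free at `𝔭̄`"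
# (cell `b2b-bsdres`, sub-cell `multr1-p2`, gen 19)

HONEST FRAMING (cell `b2b-bsdres`, run/shared/lean/b2b/bsd-rank1-residual/, verbatim in every
file): the goal of the cell is to DELETE the COMBINATION-SHAPED residual classes of the
Birch–Swinnerton-Dyer formula for ALL analytic-rank `≤ 1` elliptic curves over `ℚ` — "full BSD
formula for every rank `≤ 1` curve in class `C`" assembled STRICTLY from published theorems — so
that the rank-`≤ 1` remainder becomes exactly the CONSTRUCTION-SHAPED classes, which are TYPED
(missing-input `Prop`s), NOT attempted. This is not "finishing BSD". Sub-cell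
`b2b-bsdres-multr1-p2` (X11b, route p2); a RESEARCH ROUTE; no claim beyond the stated class; X11b
stays CONSTRUCTION-SHAPED; nothing here changes a label; no named fact is minted (theorems only; no
`sorry`).

## What is here (towards the EXACT base Selmer count, JSW17 Prop. 3.2.1 `=`)

Gens 15–17 of this sub-cell bounded Castella's level-`k` Selmer group `H¹_{𝓛^{(k)}}(K, E[p^k])`
(multr1-p1's `AcSelmer.acLevelStructure`, the structure on `E[p^∞]` PROPAGATED to `E[p^k]`) from
ABOVE by a Kummer-type group, using only the inclusion
`ker (H¹(K_v, E[p^k]) → H¹(K_v, E[p^∞])) ⊆ 𝓛_v` (propagated zero condition ⊆ local Kummer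
condition) at the places `v ∤ p`.  For the `≥` half one needs EQUALITY there.  This file proves it:

* `LocalPoints.exists_ppow_torsion_add_nsmul` — **torsion saturation of `E(K_v)` at `v ∤ p`**: every
  `Q ∈ E(K_v)` is `τ + p^k • R` with `τ` a `p`-power torsion point — from Silverman VII.6.3 in the
  tree's form `WeierstrassCurve.exists_finiteIndex_torsionFree_adicCompletion` (a torsion-free
  subgroup `U` of finite index with `[U : nU] = #𝒪_v/n`, `= 1` for `n = p^k`, `v ∤ p`);
* `localKummerMap_mem_ker_map_primaryInclusion` — at ANY `K`-field `E` (a completion), the local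
  Kummer class of a `p`-power torsion point of `(W⁄E)(E)` lies in the propagated zero condition
  `ker (H¹(E, E[p^k]) → H¹(E, E[p^∞]))` (it is the connecting class of a `p`-power root, gen 17's
  `connectingClass_eq_localKummerClass` read backwards);
* **`kummerLocalConditionAt_eq_ker_map_primaryInclusion`** — at a finite `v ∤ p`:
  `𝓛_v^{(p^k)} = ker (H¹(K_v, E[p^k]) → H¹(K_v, E[p^∞]))`, i.e. the local Kummer condition of the
  `p^k`-Selmer group IS Castella's/JSW's cohomological "locally trivial" condition read at level `k`;
* `map_torsion_localKummerMap_eq_ker_map_primaryInclusion` — at ANY `K`-field of characteristic `0`: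
  `κ((W⁄E)(E)_tors) = ker (H¹(E, E[p^k]) → H¹(E, E[p^∞]))` (gen 17 had `⊇`);
* **`selmerGroup_acLevelStructure_eq_inf_torsion`** — for `K` with all infinite places complex and
  `p = 𝔭𝔮` (every place above `p` is `𝔭` or `𝔮 ≠ 𝔭`):
  `H¹_{𝓛^{(k)}}(K, E[p^k]) = kummerOutside W (p^k) {𝔮} ⊓ loc_𝔭⁻¹ κ_𝔭(E(K_𝔭)_tors)` — EQUALITY
  (gen 17's `selmerGroup_acLevelStructure_le_inf_torsion` was `≤`): Castella's level-`k` Selmer group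
  is EXACTLY the group of `p^k`-Kummer classes away from `𝔮 = 𝔭̄` whose localisation at `𝔭` is the
  Kummer class of a torsion point.

References: [JetchevSkinnerWan2017] Prop. 3.2.1 and §2.2.3, §3.3.1 (arXiv:1512.06894 pp. 7, 10–11);
[Castella2018] Def. 2.2 (arXiv:1704.06608 p. 5); [SilvermanAEC2009] Prop. VII.6.3, VIII.§2, X.§4;
[MilneADT2006] I Lemma 3.3; [Howard2004HeegnerKolyvagin] Def. 2.1.1; [GreenbergLNM1716] §5.
-/

noncomputable section

open scoped Classical

open CategoryTheory NumberField IsDedekindDomain Field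
open Literature.NumberTheory.EllipticCurves Literature.NumberTheory.EllipticCurves.GreenbergSelmer
open Literature.NumberTheory.GaloisRepresentations
open Literature.NumberTheory.GaloisRepresentations.DiscreteGaloisModule (SelmerStructure)
open scoped ContRepresentation

universe u

namespace Summit.BirchSwinnertonDyer.Rank1Residual.X11b.LevelKummer

open Summit.BirchSwinnertonDyer.Rank1Residual.X11b.LocBridge
open Summit.BirchSwinnertonDyer.Rank1Residual.X11b.Levels
open Summit.BirchSwinnertonDyer.Rank1Residual.X11b.AcSelmer
open WeierstrassCurve (toGeomPoints)

/-! ## §0. An elementary decomposition: prime-to-`p` multiples and `p`-power torsion -/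

section Elementary

variable {A : Type*} [AddCommGroup A] (p : ℕ) [Fact p.Prime]

/-- If `N • Q = p^(a+k) • u` with `N = p^a N'`, `p ∤ N'`, then `Q = τ + p^k • R` with `p^a • τ = 0`
(Bézout: `α N' + β p^k = 1`). [folklore] -/
theorem exists_ppow_torsion_add_nsmul_of_nsmul_eq {a k N' : ℕ} (hN' : ¬ p ∣ N') {Q u : A}
    (h : (p ^ a * N') • Q = p ^ (a + k) • u) :
    ∃ τ R : A, p ^ a • τ = 0 ∧ Q = τ + p ^ k • R := by
  have hp : p.Prime := Fact.out
  -- `τ₀ := N' • Q - p^k • u` is killed by `p^a`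
  set τ₀ : A := N' • Q - p ^ k • u with hτ₀
  have hτ₀0 : p ^ a • τ₀ = 0 := by
    rw [hτ₀, smul_sub, smul_smul, smul_smul, ← pow_add, h, sub_self]
  have hNQ : N' • Q = τ₀ + p ^ k • u := by rw [hτ₀, sub_add_cancel]
  -- Bézout
  have hcop : Nat.Coprime N' (p ^ k) :=
    (Nat.Coprime.pow_right k ((Nat.Prime.coprime_iff_not_dvd hp).mpr hN').symm)
  obtain ⟨α, β, hαβ⟩ := Nat.isCoprime_iff_coprime.mpr hcop
  refine ⟨α • τ₀, α • u + β • Q, ?_, ?_⟩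
  · rw [smul_comm, hτ₀0, smul_zero]
  · calc Q = (α * (N' : ℤ) + β * ((p ^ k : ℕ) : ℤ)) • Q := by rw [hαβ, one_smul]
      _ = α • ((N' : ℤ) • Q) + β • (((p ^ k : ℕ) : ℤ) • Q) := by rw [add_smul, mul_smul, mul_smul]
      _ = α • (N' • Q) + β • (p ^ k • Q) := by rw [natCast_zsmul, natCast_zsmul]
      _ = α • τ₀ + p ^ k • (α • u + β • Q) := by
          rw [hNQ, smul_add, smul_add, smul_comm α (p ^ k) u, smul_comm β (p ^ k) Q]
          abel

/-- In an additive commutative group with a torsion-free subgroup `U` of finite index which is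
`p`-divisible inside itself (`U ≤ p • U`), every element is `τ + p^k • R` with `τ` a `p`-power
torsion element. [folklore] -/
theorem exists_ppow_torsion_add_nsmul_of_subgroup (U : AddSubgroup A) [U.FiniteIndex]
    (hdiv : ∀ j : ℕ, U ≤ U.map (nsmulAddMonoidHom (p ^ j) : A →+ A)) (k : ℕ) (Q : A) :
    ∃ (τ R : A) (a : ℕ), p ^ a • τ = 0 ∧ Q = τ + p ^ k • R := by
  have hp : p.Prime := Fact.out
  have hN : U.index ≠ 0 := AddSubgroup.FiniteIndex.index_ne_zero
  obtain ⟨a, N', hN', hfac⟩ := Nat.exists_eq_pow_mul_and_not_dvd hN p hp.one_lt.ne'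
  have hmem : U.index • Q ∈ U := U.nsmul_index_mem Q
  obtain ⟨u, -, hu⟩ := hdiv (a + k) hmem
  have h : (p ^ a * N') • Q = p ^ (a + k) • u := by rw [← hfac, ← hu, nsmulAddMonoidHom_apply]
  obtain ⟨τ, R, hτ, hQ⟩ := exists_ppow_torsion_add_nsmul_of_nsmul_eq p hN' h
  exact ⟨τ, R, a, hτ, hQ⟩

/-- A torsion element of an additive commutative group is `τ + p^k • R` with `τ` a `p`-power torsion
element (split off the prime-to-`p` part of its order by Bézout). [folklore] -/
theorem exists_ppow_torsion_add_nsmul_of_isOfFinAddOrder (k : ℕ) {Q : A} (hQ : IsOfFinAddOrder Q) :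
    ∃ (τ R : A) (a : ℕ), p ^ a • τ = 0 ∧ Q = τ + p ^ k • R := by
  have hp : p.Prime := Fact.out
  have hN : addOrderOf Q ≠ 0 := (IsOfFinAddOrder.addOrderOf_pos hQ).ne'
  obtain ⟨a, N', hN', hfac⟩ := Nat.exists_eq_pow_mul_and_not_dvd hN p hp.one_lt.ne'
  have h : (p ^ a * N') • Q = p ^ (a + k) • (0 : A) := by
    rw [← hfac, addOrderOf_nsmul_eq_zero, smul_zero]
  obtain ⟨τ, R, hτ, hQ⟩ := exists_ppow_torsion_add_nsmul_of_nsmul_eq p hN' h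
  exact ⟨τ, R, a, hτ, hQ⟩

end Elementary

/-! ## §1. Torsion saturation of `E(K_v)` at `v ∤ p` (Silverman VII.6.3) -/

section LocalPoints

variable {K : Type u} [Field K] [NumberField K] (W : WeierstrassCurve K) [W.IsElliptic]
  (p : ℕ) [Fact p.Prime] (v : HeightOneSpectrum (𝓞 K))

/-- **Torsion saturation at `v ∤ p`**: every `Q ∈ E(K_v)` is `τ + p^k • R` with `τ` a `p`-power
torsion point of `E(K_v)` — `E(K_v)` has a torsion-free subgroup `U` of finite index with
`[U : p^j U] = #(𝒪_v/p^j) = 1` (Silverman VII.6.3, tree `exists_finiteIndex_torsionFree_adicCompletion`;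
`#(𝒪_v/p^j) = 1` for `v ∤ p`), so `U` is `p`-divisible and the prime-to-`p` part of `[E(K_v) : U]`
is split off by Bézout.  Equivalently `E(K_v) ⊗ ℚ_p/ℤ_p = 0`, the fact behind JSW17's
"`H¹_f(K_w, W) = 0` for `w ∤ p`". [cite: SilvermanAEC2009, Prop. VII.6.3]
[cite: MilneADT2006, I Lemma 3.3] [cite: JetchevSkinnerWan2017, §2.2.3 (arXiv:1512.06894 p. 7)] -/
theorem LocalPoints.exists_ppow_torsion_add_nsmul (hpv : ((p : ℕ) : 𝓞 K) ∉ v.asIdeal) (k : ℕ)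
    (Q : (W.baseChange (v.adicCompletion K)).toAffine.Point) :
    ∃ (τ R : (W.baseChange (v.adicCompletion K)).toAffine.Point) (a : ℕ),
      p ^ a • τ = 0 ∧ Q = τ + p ^ k • R := by
  obtain ⟨U, hU, htf, hidx⟩ := W.exists_finiteIndex_torsionFree_adicCompletion v
  haveI := hU
  refine exists_ppow_torsion_add_nsmul_of_subgroup p U (fun j ↦ ?_) k Q
  have hj : p ^ j ≠ 0 := pow_ne_zero j (Fact.out : p.Prime).ne_zero
  have h1 : (U.map (nsmulAddMonoidHom (p ^ j) : _ →+ _)).relIndex U = 1 := by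
    rw [hidx (p ^ j) hj]
    exact LocBridge.natCard_quotient_span_pow_eq_one p v hpv j
  exact AddSubgroup.relIndex_eq_one.mp h1

end LocalPoints

/-! ## §2. Kummer classes of `p`-power torsion points lie in the propagated zero condition -/

section Local

variable {K : Type u} [Field K] [CharZero K] (W : WeierstrassCurve K) [W.IsElliptic] (p k : ℕ)
  [Fact p.Prime] (E : Type u) [Field E] [Algebra K E]

omit [CharZero K] [W.IsElliptic] [Fact p.Prime] in
/-- If `p^k • pointsMap Q` is `Γ_E`-fixed in `E(K̄_E)` then `p^k • Q` is fixed by `Γ_E` in the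
restricted module `E[p^∞](K̄)|_{Γ_E}` (`pointsMap` is an equivariant injection).  Converse of gen 17's
`zsmul_pointsMap_mem_fixedPoints`. [folklore] -/
theorem restrictField_smul_eq_of_pointsMap_mem_fixedPoints (Q : W.geomPrimaryTorsion p)
    (h : ((p ^ k : ℕ) : ℤ) • pointsMap W E (Q : W.geomPoints) ∈
      MulAction.fixedPoints (absoluteGaloisGroup E) (localPoints W E)) (σ : absoluteGaloisGroup E) :
    GaloisRep.restrictField E (primaryGaloisModule W p) σ (p ^ k • Q) = p ^ k • Q := by
  rw [GaloisRep.restrictField_apply]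
  apply Subtype.ext
  apply pointsMapOfEmb_injective W (closureEmb (K := K) E)
  change pointsMap W E (absGaloisRestrict K E σ • ((p ^ k • Q : W.geomPrimaryTorsion p) : W.geomPoints)) =
    pointsMap W E ((p ^ k • Q : W.geomPrimaryTorsion p) : W.geomPoints)
  rw [← WeierstrassCurve.resGal_eq_absGaloisRestrict, pointsMap_smul, AddSubmonoidClass.coe_nsmul,
    map_nsmul, ← natCast_zsmul]
  exact h σ

/-- **The local Kummer class of a `p`-power torsion point lies in the propagated zero condition.**
For a `K`-field `E` (a completion `K_v`) and `τ ∈ (W⁄E)(E)` with `p^a • τ = 0`: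
`κ_{p^k,E}(τ) ∈ ker (H¹(Γ_E, E[p^k]) → H¹(Γ_E, E[p^∞]))` — a `p^k`-th root `R` of `τ` in `E(K̄_E)` is
`p`-power torsion, comes from `E[p^∞](K̄)`, and `κ(τ) = [σ ↦ σR − R]` is the connecting class
`δ(R)` of `0 → E[p^k] → E[p^∞] → E[p^∞] → 0` (gen 17's `connectingClass_eq_localKummerClass`).
[cite: JetchevSkinnerWan2017, §3.3.1 (arXiv:1512.06894 p. 11), "the image of the local torsion"]
[cite: GreenbergLNM1716, §5 proof of Prop. 5.8] [cite: Howard2004HeegnerKolyvagin, Def. 2.1.1] -/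
theorem localKummerMap_mem_ker_map_primaryInclusion (hn : ((p ^ k : ℕ) : ℤ) ≠ 0)
    {τ : (W.baseChange E).toAffine.Point} {a : ℕ} (hτ : p ^ a • τ = 0) :
    W.localKummerMap E hn τ ∈
      (galoisCohomology.map ((primaryInclusion W p k).restrictField E) 1).ker := by
  have hp : p.Prime := Fact.out
  haveI : (W.baseChange (AlgebraicClosure E)).IsElliptic := by
    rw [WeierstrassCurve.baseChange]; infer_instance
  -- `τ` read in `E(K̄_E)`, and a `p^k`-th root `R'` of it
  set X : localPoints W E := W.baseChangeGeomPointsEquiv E (toGeomPoints (W.baseChange E) τ) with hX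
  obtain ⟨R', hR'⟩ : ∃ R' : localPoints W E, ((p ^ k : ℕ) : ℤ) • R' = X :=
    (W.baseChange (AlgebraicClosure E)).zsmul_surjective_of_isAlgClosed hn X
  have hN : ((p ^ (a + k) : ℕ) : ℤ) ≠ 0 := by exact_mod_cast pow_ne_zero _ hp.ne_zero
  have hR'tors : R' ∈ AddSubgroup.torsionBy (localPoints W E) ((p ^ (a + k) : ℕ) : ℤ) := by
    change ((p ^ (a + k) : ℕ) : ℤ) • R' = 0
    rw [pow_add, Nat.cast_mul, mul_smul, hR', hX, natCast_zsmul, ← map_nsmul, ← map_nsmul, hτ,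
      map_zero, map_zero]
  -- pull `R'` back to `E[p^(a+k)](K̄) ⊆ E[p^∞](K̄)`
  set R : W.geomTorsion ((p ^ (a + k) : ℕ) : ℤ) :=
    (W.torsionPointsEquiv ((p ^ (a + k) : ℕ) : ℤ) (E := E) hN).symm ⟨R', hR'tors⟩ with hR
  have hRR' : pointsMap W E (R : W.geomPoints) = R' := W.pointsMap_torsionPointsEquiv_symm _ hN _
  set Q : W.geomPrimaryTorsion p :=
    ⟨(R : W.geomPoints), geomTorsion_pow_le_geomPrimaryTorsion W p (a + k) R.2⟩ with hQ
  have hQR' : pointsMap W E (Q : W.geomPoints) = R' := hRR'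
  -- `p^k • Q` is `Γ_E`-fixed
  have hfix : ((p ^ k : ℕ) : ℤ) • pointsMap W E (Q : W.geomPoints) ∈
      MulAction.fixedPoints (absoluteGaloisGroup E) (localPoints W E) := by
    rw [hQR']
    exact W.zsmul_mem_fixedPoints_of_eq E hR'
  have hQfix := restrictField_smul_eq_of_pointsMap_mem_fixedPoints W p k E Q hfix
  -- `κ(τ) = κ_E(R') = δ(Q)`
  rw [AddMonoidHom.mem_ker, map_primaryInclusion_restrictField_eq_zero_iff]
  refine ⟨Q, hQfix, ?_⟩
  rw [connectingClass_eq_localKummerClass W p k E Q hQfix hn,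
    W.localKummerMap_eq_localKummerClass E hn τ R' (W.zsmul_mem_fixedPoints_of_eq E hR') hR']
  exact WeierstrassCurve.localKummerClass_congr hQR'.symm

variable [CharZero E]

/-- **`κ((W⁄E)(E)_tors) = ker (H¹(Γ_E, E[p^k]) → H¹(Γ_E, E[p^∞]))` at ANY `K`-field `E` of
characteristic `0`** (gen 17's `ker_map_primaryInclusion_le_map_torsion` gave `⊇`; for `⊆` split a
torsion point into its `p`-power part and a multiple of `p^k`). In particular at `𝔭` Castella's
strict condition propagated to `E[p^k]` is EXACTLY the Kummer image of the torsion of `E(K_𝔭)`.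
[cite: JetchevSkinnerWan2017, §3.3.1 (arXiv:1512.06894 p. 11)] [cite: Howard2004HeegnerKolyvagin, Def. 2.1.1] -/
theorem map_torsion_localKummerMap_eq_ker_map_primaryInclusion (hn : ((p ^ k : ℕ) : ℤ) ≠ 0) :
    (AddCommGroup.torsion (W.baseChange E).toAffine.Point).map (W.localKummerMap E hn) =
      (galoisCohomology.map ((primaryInclusion W p k).restrictField E) 1).ker := by
  refine le_antisymm ?_ (ker_map_primaryInclusion_le_map_torsion W p k E hn)
  rintro _ ⟨t, ht, rfl⟩
  obtain ⟨τ, R, a, hτ, rfl⟩ := exists_ppow_torsion_add_nsmul_of_isOfFinAddOrder p k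
    ((AddCommGroup.mem_torsion _).mp ht)
  rw [map_add]
  refine AddSubgroup.add_mem _ (localKummerMap_mem_ker_map_primaryInclusion W p k E hn hτ) ?_
  have h0 : W.localKummerMap E hn (p ^ k • R) = 0 := by
    rw [← AddMonoidHom.mem_ker, W.ker_localKummerMap E hn]
    exact ⟨R, by rw [zsmulAddGroupHom_apply, natCast_zsmul]⟩
  rw [h0]
  exact zero_mem _

end Local

/-! ## §3. At `v ∤ p` the local Kummer condition IS the propagated zero condition -/

section Away

variable {K : Type u} [Field K] [NumberField K] (W : WeierstrassCurve K) [W.IsElliptic] (p k : ℕ)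
  [Fact p.Prime] (v : HeightOneSpectrum (𝓞 K))

/-- **`𝓛_v^{(p^k)} = ker (H¹(K_v, E[p^k]) → H¹(K_v, E[p^∞]))` at every finite `v ∤ p`.** The local
Kummer condition defining `Sel^{(p^k)}(E/K)` (classes dying in `H¹(K_v, E)`) coincides with the
PROPAGATED zero condition (classes dying in `H¹(K_v, E[p^∞])`, Castella's / JSW's "locally trivial
at `w ∤ p`" read at level `k`): `⊇` is gen 15's `ker_map_primaryInclusion_le_kummerLocalConditionAt`;
`⊆` is torsion saturation (`LocalPoints.exists_ppow_torsion_add_nsmul`: a local Kummer class is the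
class of a `p`-power torsion point) and §2.  This is the finite-level content of JSW17 §2.2.3
"`H¹_f(K_w, W) = 0` if `w ∤ p`" (`E(K_w) ⊗ ℚ_p/ℤ_p = 0`).
[cite: JetchevSkinnerWan2017, §2.2.3 and Prop. 3.2.1 (arXiv:1512.06894 pp. 7, 10)]
[cite: SilvermanAEC2009, Prop. VII.6.3 and X.§4] [cite: Castella2018, Def. 2.2 (arXiv:1704.06608 p. 5)] -/
theorem kummerLocalConditionAt_eq_ker_map_primaryInclusion (hpv : ((p : ℕ) : 𝓞 K) ∉ v.asIdeal)
    (hn : ((p ^ k : ℕ) : ℤ) ≠ 0) :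
    W.kummerLocalConditionAt ((p ^ k : ℕ) : ℤ) (v.adicCompletion K) =
      (galoisCohomology.map ((primaryInclusion W p k).restrictField (v.adicCompletion K)) 1).ker := by
  haveI : CharZero (v.adicCompletion K) := charZero_adicCompletion v
  refine le_antisymm ?_ (ker_map_primaryInclusion_le_kummerLocalConditionAt W p k (v.adicCompletion K))
  intro c hc
  rw [← W.range_localKummerMap (v.adicCompletion K) hn] at hc
  obtain ⟨Q, rfl⟩ := hc
  obtain ⟨τ, R, a, hτ, rfl⟩ := LocalPoints.exists_ppow_torsion_add_nsmul W p v hpv k Q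
  rw [map_add]
  refine AddSubgroup.add_mem _
    (localKummerMap_mem_ker_map_primaryInclusion W p k (v.adicCompletion K) hn hτ) ?_
  have h0 : W.localKummerMap (v.adicCompletion K) hn (p ^ k • R) = 0 := by
    rw [← AddMonoidHom.mem_ker, W.ker_localKummerMap (v.adicCompletion K) hn]
    exact ⟨R, by rw [zsmulAddGroupHom_apply, natCast_zsmul]⟩
  rw [h0]
  exact zero_mem _

/-- **Castella's level structure at a finite `v ∤ p` outside `Σ` is the Kummer condition**:
`𝓛^{(k),Σ}_v = 𝓛_v^{(p^k)}` (`= kummerSelmerStructure W (p^k) (Sum.inr v)`).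
[cite: Castella2018, Def. 2.2 (arXiv:1704.06608 p. 5)] [cite: JetchevSkinnerWan2017, §2.2.3 (arXiv:1512.06894 p. 7)] -/
theorem acLevelStructure_inr_eq_kummerSelmerStructure_of_not_mem (𝔭 : HeightOneSpectrum (𝓞 K))
    (S : Set (HeightOneSpectrum (𝓞 K))) (hpv : ((p : ℕ) : 𝓞 K) ∉ v.asIdeal) (hvS : v ∉ S) :
    acLevelStructure W p k 𝔭 S (Sum.inr v) = W.kummerSelmerStructure ((p ^ k : ℕ) : ℤ) (Sum.inr v) := by
  have hn : ((p ^ k : ℕ) : ℤ) ≠ 0 := by exact_mod_cast pow_ne_zero k (Fact.out : p.Prime).ne_zero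
  rw [acLevelStructure_eq_ker_of W p k 𝔭 S (acStructure_of_not_mem _ p 𝔭 S hpv hvS),
    WeierstrassCurve.kummerSelmerStructure_apply]
  exact (kummerLocalConditionAt_eq_ker_map_primaryInclusion W p k v hpv hn).symm

end Away

/-! ## §4. `H¹_{𝓛^{(k)}}(K, E[p^k]) = kummerOutside W (p^k) {𝔮} ⊓ loc_𝔭⁻¹ κ_𝔭(E(K_𝔭)_tors)` -/

section Global

variable {K : Type} [Field K] [NumberField K] (W : WeierstrassCurve K) [W.IsElliptic] (p k : ℕ)
  [Fact p.Prime] (𝔭 𝔮 : HeightOneSpectrum (𝓞 K))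

/-- **Castella's level-`k` Selmer group, EXACTLY, in the Kummer vocabulary.** For a number field
`K` all of whose infinite places are complex, a prime `p` and two finite places `𝔭 ≠ 𝔮` above `p`
such that every place above `p` is `𝔭` or `𝔮` (`p = 𝔭𝔭̄` split in an imaginary quadratic field):
`H¹_{𝓛^{(k)}}(K, E[p^k]) = kummerOutside W (p^k) {𝔮} ⊓ loc_𝔭⁻¹ κ_𝔭(E(K_𝔭)_tors)` — the classes of
`H¹(K, E[p^k])` satisfying the local Kummer condition at every place other than `𝔮 = 𝔭̄` (NO
condition at `𝔮`) and whose localisation at `𝔭` is the Kummer class of a TORSION point of `E(K_𝔭)`.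
Gen 17 proved `≤` (`selmerGroup_acLevelStructure_le_inf_torsion`); `≥` is §2–§3: at `v ∤ p` the
Kummer condition IS the propagated zero condition, at `𝔭` the torsion-Kummer classes ARE the
propagated zero condition, at the complex places every local group vanishes, at `𝔮` there is no
condition on either side. [cite: Castella2018, Def. 2.2 (arXiv:1704.06608 p. 5)]
[cite: JetchevSkinnerWan2017, Prop. 3.2.1 proof and §3.3.1 (arXiv:1512.06894 pp. 10–11)]
[cite: Howard2004HeegnerKolyvagin, Def. 2.1.1 (arXiv:1202.6340 p. 5)] -/
theorem selmerGroup_acLevelStructure_eq_inf_torsion (hK : ∀ w : InfinitePlace K, w.IsComplex)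
    (h𝔮p : ((p : ℕ) : 𝓞 K) ∈ 𝔮.asIdeal) (hne : 𝔮 ≠ 𝔭)
    (hall : ∀ v : HeightOneSpectrum (𝓞 K), ((p : ℕ) : 𝓞 K) ∈ v.asIdeal → v = 𝔭 ∨ v = 𝔮)
    (hn : ((p ^ k : ℕ) : ℤ) ≠ 0) :
    (acLevelStructure W p k 𝔭 ∅).selmerGroup =
      kummerOutside W (p ^ k) {Sum.inr 𝔮} ⊓
        ((AddCommGroup.torsion
            (W.baseChange (Place.Completion (Sum.inr 𝔭 : Place K))).toAffine.Point).map
          (W.localKummerMap (Place.Completion (Sum.inr 𝔭 : Place K)) hn)).comap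
          (galoisCohomology.localization (W.torsionGaloisModule ((p ^ k : ℕ) : ℤ)) (Sum.inr 𝔭) 1) := by
  haveI : CharZero (Place.Completion (Sum.inr 𝔭 : Place K)) := charZero_adicCompletion 𝔭
  refine le_antisymm (selmerGroup_acLevelStructure_le_inf_torsion W p k 𝔭 ∅ {Sum.inr 𝔮} ?_ hn) ?_
  · intro v hv hpv
    rcases hpv with hpv | hvS
    · rcases hall v hpv with rfl | rfl
      · exact absurd rfl hv
      · exact Finset.mem_singleton_self _
    · exact absurd hvS (Set.notMem_empty v)
  · rintro c ⟨hcKO, hc𝔭⟩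
    refine (SelmerStructure.mem_selmerGroup_iff _ c).mpr fun v ↦ ?_
    rcases v with w | v
    · rw [acLevelStructure_inl_eq_top_of_isComplex W p k 𝔭 ∅ (hK w)]
      exact AddSubgroup.mem_top _
    · by_cases hv𝔭 : v = 𝔭
      · subst hv𝔭
        rw [acLevelStructure_eq_ker_of W p k v ∅ (acStructure_self _ p v ∅),
          ← map_torsion_localKummerMap_eq_ker_map_primaryInclusion W p k _ hn]
        exact hc𝔭
      · by_cases hpv : ((p : ℕ) : 𝓞 K) ∈ v.asIdeal
        · rw [acLevelStructure_eq_top_of_mem_of_ne W p k 𝔭 ∅ hpv hv𝔭]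
          exact AddSubgroup.mem_top _
        · rw [acLevelStructure_inr_eq_kummerSelmerStructure_of_not_mem W p k v 𝔭 ∅ hpv
            (Set.notMem_empty v)]
          have hvq : (Sum.inr v : Place K) ∉ ({Sum.inr 𝔮} : Finset (Place K)) := by
            rw [Finset.mem_singleton]
            intro h
            obtain rfl := Sum.inr_injective h
            exact hpv h𝔮p
          exact (mem_kummerOutside_iff W (p ^ k) {Sum.inr 𝔮} c).mp hcKO (Sum.inr v) hvq

end Global

end Summit.BirchSwinnertonDyer.Rank1Residual.X11b.LevelKummer

end
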